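/-
VALUE = THEOREM, NOT summit progress (cell b2b-lgcu-borel, gen 25); crux 14079 untouched.
-/
import Mathlib
import Summits.MatrixMultiplication.MatrixMultiplication.Theorems.SubgroupIdentityDesigns.Negative.NormalSylowLaw
import Summits.MatrixMultiplication.MatrixMultiplication.Theorems.SubgroupIdentityDesigns.Negative.RootElements

/-!
# Transvection dichotomy (`m = 3`): a member containing a transvection has a normal Sylow
# `p`-subgroup or an OPPOSITE pair of root groups

VALUE = THEOREM (structure law on HYPOTHETICAL level-one witnesses of the crux
`SubgroupIdentityDesigns`, `k = 1`), NOT summit progress.  The crux item is neither restated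
nor weakened; this file is a `--supports` helper under `Negative/`.

THEOREM (`crux_transvection_dichotomy`).  For a subgroup-TPP triple of `GL₃(𝔽_p)` (`p ≥ 3`)
carrying a level-one identity design and satisfying the crux inequality (`−2 < ε ≤ 1`), and a
member `H` containing a transvection `t = 1 + c ⊗ φ` (`c, φ ≠ 0`, `φ(c) = 0`): EITHER every
Sylow `p`-subgroup of `H` is normal (so `H` is reducible, `NormalSylowLaw`), OR `H` contains `k`
with `φ(k c) ≠ 0` and `(φ k⁻¹)(c) ≠ 0` — the root groups of `t` and `k t k⁻¹` form an OPPOSITE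
pair (the centre of each lies off the axis of the other; such a pair generates a conjugate of
`SL₂(𝔽_p) ⊕ 1`, the configuration of `CuspidalObstructionPlacements`).

PROOF.  If some Sylow `p`-subgroup `P₀` of `H` is not normal then `|P₀| ≤ p`
(`NormalSylowLaw.crux_sylow_three`, from the member window), so `p² ∤ |H|`, and
`RootElements.exists_conj_not_mem` gives `k ∈ H` with `t' = k t k⁻¹ = 1 + c' ⊗ φ'` outside the
root group of `t`.  If `φ(c') = φ'(c) = 0` the pair `(t, t')` is orthogonal and independent;
if exactly one of them vanishes, the commutator `[t', t]` (resp. `[t, t']`) is a transvection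
`1 + φ'(c) · c' ⊗ φ` (resp. `1 + φ(c') · c ⊗ φ'`) orthogonal to and independent of `t'`
(resp. `t`) (`RootElements.coe_comm`, `indep_same_centre`).  In the three cases
`RootElements.sq_dvd_card_of_pair` gives `p² ∣ |H|` — contradiction; so both are non-zero.

CONSEQUENCE (recorded in the cell's ORACLE-g25 §G25-3/4).  With `UnitriangularSylow` and
`NormalSylowLaw` this sorts every member of a hypothetical `(3,1)` witness containing a
transvection into: normal Sylow of order `p` or `p²` (reducible, `H ≤ N(P)`), or an opposite
root pair (an `SL₂(𝔽_p) ⊕ 1`-conjugate inside `H`, to be excluded by the cuspidal obstruction).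

HONEST SCOPE.  Structure law; it empties no `(p, m, ε)` cell.  Sorry-free; standard axioms.
-/

set_option linter.dupNamespace false

noncomputable section

open scoped BigOperators Classical Matrix

namespace Summit.MatrixMultiplication.MatrixMultiplication.Theorems.SubgroupIdentityDesigns.Negative
namespace TransvectionSylow

open Summit.MatrixMultiplication.MatrixMultiplication.Theorems.LieRankDesigns.Negative (GLm Mat budget)
open Literature.Barriers.MatrixMultiplication (SubgroupTPP)
open Matrix (vecMulVec)
open RootElements (coe_conj conj_dot coe_comm vecMul_inv_ne_zero sq_dvd_card_of_pair
  exists_conj_not_mem indep_same_centre)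

variable {p : ℕ} [hp : Fact p.Prime]

section Crux

variable {H₁ H₂ H₃ : Subgroup (GLm p 3)}

/-- **TRANSVECTION DICHOTOMY (`m = 3`, any member).**  For a subgroup-TPP triple of `GL₃(𝔽_p)`
(`p ≥ 3`) carrying a level-one identity design and satisfying the crux inequality with
`−2 < ε ≤ 1`, and a member `H` containing a transvection `t = 1 + c ⊗ φ`: either EVERY Sylow
`p`-subgroup of `H` is normal, or some `k ∈ H` has `φ(k c) ≠ 0` and `(φ k⁻¹)(c) ≠ 0` (the root
groups of `t` and `k t k⁻¹` are an opposite pair). -/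
theorem crux_transvection_dichotomy (hp3 : 3 ≤ p) {ε : ℝ} (hε : -2 < ε) (hε1 : ε ≤ 1)
    (htpp : SubgroupTPP H₁ H₂ H₃)
    (hdes : ∃ cf : Mat p 3 → ℂ, (∀ M, 1 < M.rank → cf M = 0) ∧
      (∑ M, cf M * ZMod.stdAddChar (Matrix.trace (M * ((1 : GLm p 3) : Mat p 3)))) = 1 ∧
      ∀ a ∈ H₁, ∀ b ∈ H₂, ∀ g ∈ H₃, a * b * g ≠ 1 →
        (∑ M, cf M * ZMod.stdAddChar (Matrix.trace (M * ((a * b * g : GLm p 3) : Mat p 3)))) = 0)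
    (hlt : budget p 3 1 (2 + ε) < ((Nat.card H₁ * Nat.card H₂ * Nat.card H₃ : ℕ) : ℝ) ^ ((2 + ε) / 3))
    (H : Subgroup (GLm p 3)) (hH : H = H₁ ∨ H = H₂ ∨ H = H₃)
    {t : GLm p 3} (htH : t ∈ H) {c φ : Fin 3 → ZMod p} (ht : (t : Mat p 3) = 1 + vecMulVec c φ)
    (hc : c ≠ 0) (hφ : φ ≠ 0) (hφc : φ ⬝ᵥ c = 0) :
    (∀ P : Sylow p H, (P : Subgroup H).Normal) ∨
      ∃ k ∈ H, φ ⬝ᵥ ((k : Mat p 3) *ᵥ c) ≠ 0 ∧ (φ ᵥ* ((k⁻¹ : GLm p 3) : Mat p 3)) ⬝ᵥ c ≠ 0 := by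
  by_cases hN : ∀ P : Sylow p H, (P : Subgroup H).Normal
  · exact Or.inl hN
  right
  push Not at hN
  obtain ⟨P₀, hP₀⟩ := hN
  -- the non-normal Sylow subgroup is small
  obtain ⟨h1, h2, h3⟩ := NormalSylowLaw.crux_sylow_three hp3 hε hε1 htpp hdes hlt
  have hsmall : Nat.card P₀ ≤ p := by
    rcases hH with rfl | rfl | rfl
    · exact (h1 P₀).resolve_left hP₀
    · exact (h2 P₀).resolve_left hP₀
    · exact (h3 P₀).resolve_left hP₀
  have hnsq : ¬ p ^ 2 ∣ Nat.card H := by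
    intro hdvd
    have h2le : 2 ≤ (Nat.card H).factorization p :=
      (hp.out.pow_dvd_iff_le_factorization Nat.card_pos.ne').mp hdvd
    have hcardP : Nat.card P₀ = p ^ (Nat.card H).factorization p := P₀.card_eq_multiplicity
    have h21 : p ^ 2 ≤ p ^ 1 := by
      calc p ^ 2 ≤ p ^ (Nat.card H).factorization p := Nat.pow_le_pow_right hp.out.pos h2le
        _ = Nat.card P₀ := hcardP.symm
        _ ≤ p ^ 1 := by rw [pow_one]; exact hsmall
    exact absurd h21 (not_le.mpr (Nat.pow_lt_pow_right hp.out.one_lt (by norm_num)))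
  -- a conjugate `t' = k t k⁻¹ = 1 + c' ⊗ φ'` outside the root group of `t`
  obtain ⟨k, hkH, hk⟩ := exists_conj_not_mem htH ht hc hφ hφc P₀ hP₀ hsmall
  set c' : Fin 3 → ZMod p := (k : Mat p 3) *ᵥ c with hc'
  set φ' : Fin 3 → ZMod p := φ ᵥ* ((k⁻¹ : GLm p 3) : Mat p 3) with hφ'
  have ht'H : k * t * k⁻¹ ∈ H := H.mul_mem (H.mul_mem hkH htH) (H.inv_mem hkH)
  have ht' : ((k * t * k⁻¹ : GLm p 3) : Mat p 3) = 1 + vecMulVec c' φ' := coe_conj t k ht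
  have hφ'c' : φ' ⬝ᵥ c' = 0 := by rw [hc', hφ', conj_dot, hφc]
  have hc'0 : c' ≠ 0 := glm_mulVec_ne_zero k hc
  have hφ'0 : φ' ≠ 0 := vecMul_inv_ne_zero k hφ
  -- `c' ⊗ φ'` is not a multiple of `c ⊗ φ`
  have hk' : ∀ a : ZMod p, vecMulVec c' φ' ≠ a • vecMulVec c φ := by
    intro a h
    exact hk a (by rw [ht', h])
  refine ⟨k, hkH, fun h0 => ?_, fun h0 => ?_⟩
  · -- `φ(c') = 0`
    by_cases h2 : φ' ⬝ᵥ c = 0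
    · -- both incidences: the pair `(t, t')` is orthogonal and independent
      refine hnsq (sq_dvd_card_of_pair htH ht'H ht ht' hφc hφ'c' h0 h2 ?_)
      intro a b hab
      by_cases hb : b = 0
      · rw [hb, zero_smul, add_zero, smul_eq_zero] at hab
        exact ⟨hab.resolve_right (Matrix.vecMulVec_ne_zero hc hφ), hb⟩
      · exfalso
        apply hk' (-(b⁻¹ * a))
        have := congrArg (fun M : Mat p 3 => b⁻¹ • M) hab
        simp only [smul_add, smul_smul, inv_mul_cancel₀ hb, one_smul, smul_zero] at this
        rw [neg_smul, eq_neg_iff_add_eq_zero, add_comm, this]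
    · -- one incidence: the commutator `[t', t] = 1 + φ'(c) · c' ⊗ φ` pairs with `t'`
      have hwH : (k * t * k⁻¹) * t * (k * t * k⁻¹)⁻¹ * t⁻¹ ∈ H :=
        H.mul_mem (H.mul_mem (H.mul_mem ht'H htH) (H.inv_mem ht'H)) (H.inv_mem htH)
      have hw := coe_comm (k * t * k⁻¹) t ht' ht hφ'c' hφc h0
      refine hnsq (sq_dvd_card_of_pair ht'H hwH ht' hw hφ'c' ?_ hφ'c' ?_ ?_)
      · rw [smul_dotProduct, h0, smul_zero]
      · rw [smul_dotProduct, h0, smul_zero]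
      · exact indep_same_centre hc'0 h2 h2 hφ hφc
  · -- `φ'(c) = 0` but `φ(c') ≠ 0`: the commutator `[t, t'] = 1 + φ(c') · c ⊗ φ'` pairs with `t`
    have h1' : φ ⬝ᵥ c' ≠ 0 := by
      intro h1
      -- then we are in the previous case with the roles fixed: rerun the orthogonal pair
      refine hnsq (sq_dvd_card_of_pair htH ht'H ht ht' hφc hφ'c' h1 h0 ?_)
      intro a b hab
      by_cases hb : b = 0
      · rw [hb, zero_smul, add_zero, smul_eq_zero] at hab
        exact ⟨hab.resolve_right (Matrix.vecMulVec_ne_zero hc hφ), hb⟩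
      · exfalso
        apply hk' (-(b⁻¹ * a))
        have := congrArg (fun M : Mat p 3 => b⁻¹ • M) hab
        simp only [smul_add, smul_smul, inv_mul_cancel₀ hb, one_smul, smul_zero] at this
        rw [neg_smul, eq_neg_iff_add_eq_zero, add_comm, this]
    have hwH : t * (k * t * k⁻¹) * t⁻¹ * (k * t * k⁻¹)⁻¹ ∈ H :=
      H.mul_mem (H.mul_mem (H.mul_mem htH ht'H) (H.inv_mem htH)) (H.inv_mem ht'H)
    have hw := coe_comm t (k * t * k⁻¹) ht ht' hφc hφ'c' h0
    refine hnsq (sq_dvd_card_of_pair htH hwH ht hw hφc ?_ hφc ?_ ?_)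
    · rw [smul_dotProduct, h0, smul_zero]
    · rw [smul_dotProduct, h0, smul_zero]
    · exact indep_same_centre hc h1' h1' hφ'0 hφ'c'

end Crux

end TransvectionSylow
end Summit.MatrixMultiplication.MatrixMultiplication.Theorems.SubgroupIdentityDesigns.Negative
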